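import Literature.MathematicalPhysics.QuantumFieldTheory.Balaban1983to89.B6Ineq249TwoLevelBox

/-!
# `Balaban1983to89.B6Prop22TwoLevelBox` — [B6] Proposition 2.2, FIRST ENTRY of (2.67), `|(G′λ)(x)| ≤ O(1)e^{−½δ₀d(y,y′)}|λ|`,
ALONG THE PRINTED ROUTE (2.50)–(2.55), (2.64)–(2.66) (decay of `G′₀`, smallness AND decay of `R`, resummation) FOR THE
GENUINE TWO-LEVEL OPERATOR `Δ_Ω^{L^{−j},N} + m² + Q′*aQ′` ON A BOX OF `L`-BLOCKS — uniformly in the mesh and the volume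
(file 4 of the two-level parametrix; no existing module is touched; no fact is minted)

FRAMING (verbatim cell line):
statement-level skeleton of published theorems with citation tags; proofs where landed; nothing here is a claim about the Yang–Mills mass gap

Source under audit (cell pub-balaban): T. Bałaban, *Propagators and renormalization transformations for lattice gauge
theories. II*, Commun. Math. Phys. **96** (1984) 223–250 [`Balaban1984PropagatorsII`, "B6"], p. 232 [PDF 10] (2.50)–(2.55),
p. 234 [PDF 12] (2.64)–(2.67), Proposition 2.2 (renders `b2b-balaban-ref1/pages/1984-cmp96-propagators-rt-II/…-p010-x2.png`,
`…-p012-x2.png`, read as images this generation).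

## WHAT IS PRINTED (pp. 232, 234, verbatim up to notation)

p. 232: «To investigate properties of G′, and especially an exponential decay, we will use another bound for the operator
R. From (2.44) and (2.38) we have |(Rλ)(x)| ≤ O(M^{−1})e^{−δ₀d(x,y)}|λ| if supp λ ⊂ B^j(y) (2.51) … this property is
preserved under the composition of operators possessing it. A summation preserves it also, so we will have it for the
operator G′.»  p. 234: «Applying the above estimates to Rⁿ … |(Rⁿλ)(x)| ≤ (O(M^{−1})c₁)ⁿe^{−½δ₀d(y,y′)}|λ| (2.65) … and
finally |(G′λ)(x)| ≤ Σ_n |(G′₀Rⁿλ)(x)| ≤ O(1)(L^jη)²e^{−½δ₀d(y,y′)}|λ| (2.66) for M sufficiently large … Proposition 2.2.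
If we have (2.1), (2.2) and M is sufficiently large, then the operator G′ = Δ′_a^{−1} satisfies |(G′λ)(x)| ≤
O(1)(L^jη)²e^{−½δ₀d(y,y′)}|λ| …, x ∈ B^j(y), supp λ ⊂ B^{j′}(y′) (2.67). The expansion (2.50) is convergent in the L^∞
operator norm and in the norms defined by the above inequalities.»

## WHAT THIS FILE CERTIFIES (kernel-checked; `A = 0`; the lineage is USED, not re-proved)

Setting of `B6Eq238TwoLevelBox`/`B6Ineq249TwoLevelBox` (`L = ℓ + 1`, `n = L^k` fine sites per unit (`j`-)block, cube
half-width `M = L·M_h`, box `Ω` of `L`-blocks, `E = twoLevelOp n ℓ a_j a m² (M_h·P) Λ`, `G′ = gTwoLevel … = E^{−1}`,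
`G′₀ = B6Eq250.gZero hDiag gPad`, `R = B6Eq250.rOp E hDiag gPad`).  «The norms defined by the above inequalities» are
realised by the EXPONENTIALLY WEIGHTED ROW FUNCTIONAL `roww_δ(T)(x) = Σ_{x′}|T(x,x′)|e^{δ|x−x′|_∞/n}` of the lineage
(`B4Thm110ZeroBox.roww`; distance on the `L^{−j}`-scale): `sup_x roww_δ(T)(x) ≤ θ` says exactly `|(Tλ)(x)| ≤
θe^{−δd(x, supp λ)}|λ|_∞` for all `λ` (`B4Thm110ZeroBox.mulVec_le_of_roww` and §1 `roww_le_of_mulVec_decay` below, the two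
directions), it is submultiplicative («preserved under the composition», `B6Ineq243TwoLevelBox.roww_mul_le`) and
subadditive («a summation preserves it also», `B4Thm110ZeroBox.roww_add_le`).
* §1 `roww_le_of_mulVec_decay` — FROM THE PRINTED SHAPE (2.51) TO THE WEIGHTED ROW BOUND: if `|(Tλ)(x)| ≤ c·e^{−δ′D/n}`
  for every `|λ| ≤ 1` supported at sup-distance `≥ D` from `x`, then `roww_δ(T)(x) ≤ ce^{δ}(1 − e^{−(δ′−δ)})^{−1}` for
  `0 ≤ δ < δ′` (decompose the row into the shells `mn ≤ |x − x′|_∞ < (m+1)n` and test with the sign of the row on each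
  shell — the (2.52)/(2.56) block resummation in one line);
* §2 bookkeeping: `roww` of a padded cube operator (`roww_pad_emb`, `roww_pad_off`), of `h·T·h` (`roww_diag_mul_diag_le`),
  of a sum (`roww_sum_le`), one entry against the row (`abs_apply_le_roww`);
* §3 **(2.51)/(2.65)-input** `roww_rOp_le`: `sup_x roww_{δ₁}(R)(x) ≤ C_R/M` for every mesh `k ≥ 1`, `M_h ≥ 3`, volume,
  block union, window point (from `B6Ineq249TwoLevelBox.ineq251_twoLevelBox` by §1); **(2.64)-input** `roww_gZero_le`:
  `sup_x roww_{δ₂}(G′₀)(x) ≤ 2^{d+1}c′` (from (2.43)₁ `B6Ineq243TwoLevelBox.ineq243_twoLevel_roww` on the cut cubes and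
  the finite overlap);
* §4 **(2.66) ⇒ (2.67)₁** `prop22_entry1_twoLevelBox`: there are `δ, M₀, C > 0` (functions of `d`, `ℓ`, window) such that
  for EVERY `k ≥ 1`, `M_h ≥ 3` with `L·M_h ≥ M₀`, volume `P`, block union `Λ`, window point:
  `sup_x roww_δ(G′)(x) ≤ C` — by the fixed-point form `G′ = G′₀ + G′R` of (2.38)/(2.50) (`gTwoLevel_eq_gZero_add`) and
  `roww(G′) ≤ roww(G′₀) + roww(G′)·sup roww(R) ≤ 2^{d+1}c′ + ½roww(G′)`; hence the kernel decay
  `|G′(x,x′)| ≤ Ce^{−δ|x−x′|_∞/n}` (`gTwoLevel_entry_decay`) and the printed value form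
  `|(G′λ)(x)| ≤ Ce^{−δD/n}F` for `|λ| ≤ F` supported at sup-distance `≥ D` from `x` (`gTwoLevel_value_decay`) — the first
  entry of (2.67) in the lattice units of `twoLevelOp` (lengths in `L^{−j}`-blocks; cf. the unit discussion in
  `B6Ineq243TwoLevelBox`).

## HONEST SCOPE

`k = 1`, `A = 0`, Neumann box for the torus, one cube size; the decay rate `δ` and `C` are existential functions of
`d, ℓ` and the window (no numerical `½δ₀`); the derivative and Hölder entries of (2.67) are not treated.  AS A BOUND the
conclusion is not new: `Ω` is itself a box, so (2.43)₁ `ineq243_twoLevel_roww` applied to `Ω` gives it in one line; what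
is certified here is the printed ROUTE (2.38)/(2.50) → (2.51) → (2.64)–(2.66) for the genuine objects, in the
weighted-row guise (the lattice sums (2.61)–(2.63) of Lemma 2.1 are replaced by the shell resummation of §1; the walk sum
(2.50)₃ itself is `B6Eq250.neumann250_walks`, abstract).  Nothing is inferred from the manuscript: every step is
kernel-checked.
-/

namespace Literature.MathematicalPhysics.QuantumFieldTheory.Balaban1983to89.B6Prop22TwoLevelBox

open Finset Matrix
open Literature.MathematicalPhysics.QuantumFieldTheory.Balaban1983to89.B4Reflection242 (boxDom mem_boxDom)
open Literature.MathematicalPhysics.QuantumFieldTheory.Balaban1983to89.B4ContourShift (supNorm supNorm_nonneg)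
open Literature.MathematicalPhysics.QuantumFieldTheory.Balaban1983to89.B4Lemma22ReduceZero (Box)
open Literature.MathematicalPhysics.QuantumFieldTheory.Balaban1983to89.B4Thm110ZeroBox (roww roww_nonneg roww_add_le
  mulVec_le_of_roww)
open Literature.MathematicalPhysics.QuantumFieldTheory.Balaban1983to89.B6Ineq243TwoLevelBox
open Literature.MathematicalPhysics.QuantumFieldTheory.Balaban1983to89.B6Partition236TwoLevelBox
open Literature.MathematicalPhysics.QuantumFieldTheory.Balaban1983to89.B6Eq238TwoLevelBox
open Literature.MathematicalPhysics.QuantumFieldTheory.Balaban1983to89.B6Ineq249TwoLevelBox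

noncomputable section

variable {d : ℕ}

/-! ## §1 From the printed shape `|(Tλ)(x)| ≤ c·e^{−δ′d(x, supp λ)}|λ|` to the weighted row bound -/

section Shell

variable {N : Fin (d + 1) → ℕ}

/-- the SHELL INDEX of `x′` seen from `x`: `m = ⌊|x − x′|_∞/n⌋`, i.e. `mn ≤ |x − x′|_∞ < (m+1)n` (the block
decomposition «Σ_{y″}Δ(y″) = I» of (2.52), radially). [cite: Balaban1984PropagatorsII, (2.52) p.232, dictionary] -/
def shell (n : ℕ) (x x' : ↥(boxDom N)) : ℕ := ⌊supNorm (x.1 - x'.1) / (n : ℝ)⌋₊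

/-- `mn ≤ |x − x′|_∞`. [cite: Balaban1984PropagatorsII, (2.52) p.232, dictionary] -/
theorem shell_mul_le {n : ℕ} (hn : 1 ≤ n) (x x' : ↥(boxDom N)) :
    (shell n x x' : ℝ) * n ≤ supNorm (x.1 - x'.1) := by
  have hn' : (0 : ℝ) < n := by exact_mod_cast hn
  have := Nat.floor_le (div_nonneg (supNorm_nonneg (x.1 - x'.1)) hn'.le)
  unfold shell
  rwa [le_div_iff₀ hn'] at this

/-- `|x − x′|_∞ < (m+1)n`. [cite: Balaban1984PropagatorsII, (2.52) p.232, dictionary] -/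
theorem lt_shell_add_one_mul {n : ℕ} (hn : 1 ≤ n) (x x' : ↥(boxDom N)) :
    supNorm (x.1 - x'.1) < ((shell n x x' : ℝ) + 1) * n := by
  have hn' : (0 : ℝ) < n := by exact_mod_cast hn
  have := Nat.lt_floor_add_one (supNorm (x.1 - x'.1) / (n : ℝ))
  unfold shell
  rwa [div_lt_iff₀ hn'] at this

/-- the TEST FUNCTION of the shell `m`: the sign of the row of `T` on the shell, `0` elsewhere.
[cite: Balaban1984PropagatorsII, (2.52) p.232, dictionary] -/
def shellFn (n : ℕ) (T : Matrix ↥(boxDom N) ↥(boxDom N) ℝ) (x : ↥(boxDom N)) (m : ℕ) : ↥(boxDom N) → ℝ :=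
  fun x' => if shell n x x' = m then (if 0 ≤ T x x' then 1 else -1) else 0

/-- `|shellFn| ≤ 1`. [cite: Balaban1984PropagatorsII, (2.52) p.232, dictionary] -/
theorem abs_shellFn_le (n : ℕ) (T : Matrix ↥(boxDom N) ↥(boxDom N) ℝ) (x : ↥(boxDom N)) (m : ℕ) (x' : ↥(boxDom N)) :
    |shellFn n T x m x'| ≤ 1 := by
  unfold shellFn
  split_ifs <;> simp

/-- the row of `T` tested against the shell function is the `ℓ¹` mass of the row on the shell.
[cite: Balaban1984PropagatorsII, (2.52) p.232, dictionary] -/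
theorem mulVec_shellFn (n : ℕ) (T : Matrix ↥(boxDom N) ↥(boxDom N) ℝ) (x : ↥(boxDom N)) (m : ℕ) :
    (T *ᵥ shellFn n T x m) x = ∑ x' ∈ Finset.univ.filter (fun x' => shell n x x' = m), |T x x'| := by
  rw [Matrix.mulVec, dotProduct, Finset.sum_filter]
  refine Finset.sum_congr rfl fun x' _ => ?_
  unfold shellFn
  by_cases hm : shell n x x' = m
  · rw [if_pos hm, if_pos hm]
    by_cases h0 : 0 ≤ T x x'
    · rw [if_pos h0, mul_one, abs_of_nonneg h0]
    · rw [if_neg h0, mul_neg_one, abs_of_neg (lt_of_not_ge h0)]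
  · rw [if_neg hm, if_neg hm, mul_zero]

/-- **FROM THE PRINTED SHAPE (2.51) TO THE WEIGHTED ROW BOUND** («this property is preserved under the composition …
A summation preserves it also»: the weighted row functional is the book-keeping device): if `|(Tλ)(x)| ≤ c·e^{−δ′D/n}` for
every `|λ| ≤ 1` supported at sup-distance `≥ D` from `x`, then `Σ_{x′}|T(x,x′)|e^{δ|x−x′|_∞/n} ≤ ce^{δ}(1 − e^{−(δ′−δ)})^{−1}`
for `0 ≤ δ < δ′`. [cite: Balaban1984PropagatorsII, (2.51)–(2.52), (2.55)–(2.56) pp.232–233] -/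
theorem roww_le_of_mulVec_decay {n : ℕ} (hn : 1 ≤ n) (T : Matrix ↥(boxDom N) ↥(boxDom N) ℝ) (x : ↥(boxDom N))
    {c δ' δ : ℝ} (hc : 0 ≤ c) (hδ : 0 ≤ δ) (hδδ' : δ < δ')
    (hT : ∀ (g : ↥(boxDom N) → ℝ) (D : ℝ), (∀ x', |g x'| ≤ 1) → (∀ x', g x' ≠ 0 → D ≤ supNorm (x.1 - x'.1)) →
      |(T *ᵥ g) x| ≤ c * Real.exp (-(δ' * D / n))) :
    roww δ n T x ≤ c * Real.exp δ / (1 - Real.exp (-(δ' - δ))) := by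
  have hn' : (0 : ℝ) < n := by exact_mod_cast hn
  set r : ℝ := Real.exp (-(δ' - δ)) with hr
  have hr0 : 0 ≤ r := (Real.exp_pos _).le
  have hr1 : r < 1 := by rw [hr]; exact Real.exp_lt_one_iff.2 (by linarith)
  -- each shell contributes at most `c e^{δ} r^m`
  have hshell : ∀ m : ℕ, ∑ x' ∈ Finset.univ.filter (fun x' => shell n x x' = m),
      |T x x'| * Real.exp (δ * supNorm (x.1 - x'.1) / n) ≤ c * Real.exp δ * r ^ m := by
    intro m
    have hw : ∀ x' ∈ Finset.univ.filter (fun x' => shell n x x' = m),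
        |T x x'| * Real.exp (δ * supNorm (x.1 - x'.1) / n) ≤ |T x x'| * Real.exp (δ * ((m : ℝ) + 1)) := by
      intro x' hx'
      have hm : shell n x x' = m := (Finset.mem_filter.1 hx').2
      refine mul_le_mul_of_nonneg_left (Real.exp_le_exp.2 ?_) (abs_nonneg _)
      rw [div_le_iff₀ hn']
      have := lt_shell_add_one_mul hn x x'
      rw [hm] at this
      nlinarith
    refine (Finset.sum_le_sum hw).trans ?_
    rw [← Finset.sum_mul, ← mulVec_shellFn]
    have hval := hT (shellFn n T x m) ((m : ℝ) * n) (abs_shellFn_le n T x m) (fun x' hx' => by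
      have hm : shell n x x' = m := by
        by_contra h; exact hx' (by unfold shellFn; rw [if_neg h])
      have := shell_mul_le hn x x'
      rwa [hm] at this)
    have habs : (T *ᵥ shellFn n T x m) x ≤ c * Real.exp (-(δ' * ((m : ℝ) * n) / n)) :=
      (le_abs_self _).trans hval
    have e : c * Real.exp (-(δ' * ((m : ℝ) * n) / n)) * Real.exp (δ * ((m : ℝ) + 1)) = c * Real.exp δ * r ^ m := by
      rw [hr, ← Real.exp_nat_mul, mul_assoc, ← Real.exp_add, mul_assoc, ← Real.exp_add]
      congr 1; congr 1
      field_simp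
      ring
    rw [← e]
    exact mul_le_mul_of_nonneg_right habs (Real.exp_pos _).le
  -- resummation over the shells
  have hmaps : ∀ x' ∈ (Finset.univ : Finset ↥(boxDom N)),
      shell n x x' ∈ Finset.univ.image (shell n x) := fun x' _ => Finset.mem_image_of_mem _ (Finset.mem_univ _)
  unfold roww
  rw [← Finset.sum_fiberwise_of_maps_to hmaps]
  refine (Finset.sum_le_sum fun m _ => hshell m).trans ?_
  rw [← Finset.mul_sum]
  have hgeom : ∑ m ∈ Finset.univ.image (shell n x), r ^ m ≤ (1 - r)⁻¹ := by
    have hs : Summable (fun m : ℕ => r ^ m) := summable_geometric_of_lt_one hr0 hr1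
    calc ∑ m ∈ Finset.univ.image (shell n x), r ^ m ≤ ∑' m : ℕ, r ^ m :=
          hs.sum_le_tsum _ (fun m _ => pow_nonneg hr0 m)
      _ = (1 - r)⁻¹ := tsum_geometric_of_lt_one hr0 hr1
  rw [div_eq_mul_inv]
  exact mul_le_mul_of_nonneg_left hgeom (by positivity)

/-- one entry against the weighted row: `|T(x,x′)| ≤ roww_δ(T)(x)·e^{−δ|x−x′|_∞/n}`. [folklore] -/
private theorem abs_apply_le_roww {δ : ℝ} (n : ℕ) (T : Matrix ↥(boxDom N) ↥(boxDom N) ℝ) (x x' : ↥(boxDom N)) :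
    |T x x'| ≤ roww δ n T x * Real.exp (-(δ * supNorm (x.1 - x'.1) / n)) := by
  have h1 : |T x x'| * Real.exp (δ * supNorm (x.1 - x'.1) / n) ≤ roww δ n T x := by
    unfold roww
    exact Finset.single_le_sum (f := fun x'' => |T x x''| * Real.exp (δ * supNorm (x.1 - x''.1) / n))
      (fun _ _ => mul_nonneg (abs_nonneg _) (Real.exp_pos _).le) (Finset.mem_univ x')
  have he : Real.exp (δ * supNorm (x.1 - x'.1) / n) * Real.exp (-(δ * supNorm (x.1 - x'.1) / n)) = 1 := by
    rw [← Real.exp_add, add_neg_cancel, Real.exp_zero]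
  calc |T x x'| = |T x x'| * Real.exp (δ * supNorm (x.1 - x'.1) / n) * Real.exp (-(δ * supNorm (x.1 - x'.1) / n)) := by
        rw [mul_assoc, he, mul_one]
    _ ≤ roww δ n T x * Real.exp (-(δ * supNorm (x.1 - x'.1) / n)) :=
        mul_le_mul_of_nonneg_right h1 (Real.exp_pos _).le

/-- `roww` of a finite sum is at most the sum of the `roww`s («A summation preserves it also»).
[cite: Balaban1984PropagatorsII, p.232] -/
theorem roww_sum_le {ι : Type*} (s : Finset ι) (δ : ℝ) (n : ℕ) (A : ι → Matrix ↥(boxDom N) ↥(boxDom N) ℝ)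
    (x : ↥(boxDom N)) : roww δ n (∑ i ∈ s, A i) x ≤ ∑ i ∈ s, roww δ n (A i) x := by
  classical
  induction s using Finset.induction_on with
  | empty =>
      simp only [Finset.sum_empty]
      unfold roww
      simp
  | insert i s hi ih =>
      rw [Finset.sum_insert hi, Finset.sum_insert hi]
      exact (roww_add_le δ n _ _ x).trans (by linarith)

/-- `roww` of `u·T·v` (multiplication operators, `|v| ≤ 1`): `≤ |u(x)|·roww(T)(x)`. [folklore] -/
private theorem roww_diag_mul_diag_le (δ : ℝ) (n : ℕ) (T : Matrix ↥(boxDom N) ↥(boxDom N) ℝ) (u v : ↥(boxDom N) → ℝ)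
    (hv : ∀ y, |v y| ≤ 1) (x : ↥(boxDom N)) :
    roww δ n (Matrix.diagonal u * T * Matrix.diagonal v) x ≤ |u x| * roww δ n T x := by
  unfold roww
  rw [Finset.mul_sum]
  refine Finset.sum_le_sum fun x' _ => ?_
  rw [Matrix.mul_diagonal, Matrix.diagonal_mul, abs_mul, abs_mul, ← mul_assoc]
  refine mul_le_mul_of_nonneg_right ?_ (Real.exp_pos _).le
  calc |u x| * |T x x'| * |v x'| ≤ |u x| * |T x x'| * 1 :=
        mul_le_mul_of_nonneg_left (hv x') (mul_nonneg (abs_nonneg _) (abs_nonneg _))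
    _ = |u x| * |T x x'| := mul_one _

/-- a sum of non-negative terms, each `≤ B`, non-zero only on terms indexed injectively by `T`: `≤ |T|·B`. [folklore] -/
private theorem sum_le_card_mul' {ι σ : Type*} [Fintype ι] [DecidableEq σ] (f : ι → ℝ) (key : ι → σ)
    (hkey : Function.Injective key) (T : Finset σ) (hT : ∀ i, f i ≠ 0 → key i ∈ T) {B : ℝ} (hB : 0 ≤ B)
    (hf : ∀ i, f i ≤ B) : ∑ i, f i ≤ T.card * B := by
  classical
  rw [← Finset.sum_filter_ne_zero]
  have hcard : (Finset.univ.filter fun i => f i ≠ 0).card ≤ T.card :=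
    Finset.card_le_card_of_injOn key (fun i hi => by
      rw [Finset.coe_filter] at hi; exact hT i hi.2) (fun i _ j _ h => hkey h)
  calc ∑ i ∈ Finset.univ.filter (fun i => f i ≠ 0), f i
      ≤ (Finset.univ.filter fun i => f i ≠ 0).card • B := Finset.sum_le_card_nsmul _ _ _ fun i _ => hf i
    _ = ((Finset.univ.filter fun i => f i ≠ 0).card : ℝ) * B := by rw [nsmul_eq_mul]
    _ ≤ T.card * B := by gcongr

end Shell

/-! ## §2 `roww` of the padded cube operators -/

section Pad

variable {ℓ k Mh : ℕ} {P : Fin (d + 1) → ℕ} {q : Fin (d + 1) → ℤ}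

/-- the weighted row of a padded cube operator at an embedded site is the weighted row on the cube (the embedding is
an isometry for `|·|_∞`). [cite: Balaban1983RegularityDecay, §2 p.575, dictionary] -/
theorem roww_pad_emb (hP : ∀ i, 1 ≤ P i) (hq : q ∈ ctrs P) (δ : ℝ) (n : ℕ)
    (T : Matrix ↥(Box d ℓ k (fun i => (ℓ + 1) * cubeM' Mh P q i)) ↥(Box d ℓ k (fun i => (ℓ + 1) * cubeM' Mh P q i)) ℝ)
    (a : ↥(Box d ℓ k (fun i => (ℓ + 1) * cubeM' Mh P q i))) :
    roww δ n ((res (emb ℓ k Mh P q hP hq))ᵀ * T * res (emb ℓ k Mh P q hP hq)) (emb ℓ k Mh P q hP hq a)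
      = roww δ n T a := by
  have hinj := emb_injective (ℓ := ℓ) (k := k) (Mh := Mh) hP hq
  unfold roww
  -- the summand vanishes off the image of `emb`
  have hoff : ∀ x' ∈ (Finset.univ : Finset ↥(Box d ℓ k (fun i => (ℓ + 1) * (Mh * P i)))),
      x' ∉ Finset.univ.image (emb ℓ k Mh P q hP hq) →
      |((res (emb ℓ k Mh P q hP hq))ᵀ * T * res (emb ℓ k Mh P q hP hq)) (emb ℓ k Mh P q hP hq a) x'|
        * Real.exp (δ * supNorm ((emb ℓ k Mh P q hP hq a).1 - x'.1) / n) = 0 := by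
    intro x' _ hx'
    have hne : ∀ b, emb ℓ k Mh P q hP hq b ≠ x' := fun b hb =>
      hx' (Finset.mem_image.2 ⟨b, Finset.mem_univ _, hb⟩)
    rw [mul_res_apply_off _ _ _ hne, abs_zero, zero_mul]
  rw [← Finset.sum_subset (Finset.subset_univ _) hoff, Finset.sum_image (fun b _ b' _ h => hinj h)]
  refine Finset.sum_congr rfl fun b _ => ?_
  rw [Matrix.mul_assoc, transpose_res_mul_apply_img hinj, mul_res_apply_img hinj, emb_sub_emb hP hq]

/-- … and vanishes at a site off the cube. [cite: Balaban1983RegularityDecay, §2 p.575, dictionary] -/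
theorem roww_pad_off (hP : ∀ i, 1 ≤ P i) (hq : q ∈ ctrs P) (δ : ℝ) (n : ℕ)
    (T : Matrix ↥(Box d ℓ k (fun i => (ℓ + 1) * cubeM' Mh P q i)) ↥(Box d ℓ k (fun i => (ℓ + 1) * cubeM' Mh P q i)) ℝ)
    {x : ↥(Box d ℓ k (fun i => (ℓ + 1) * (Mh * P i)))} (hx : ∀ b, emb ℓ k Mh P q hP hq b ≠ x) :
    roww δ n ((res (emb ℓ k Mh P q hP hq))ᵀ * T * res (emb ℓ k Mh P q hP hq)) x = 0 := by
  unfold roww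
  refine Finset.sum_eq_zero fun x' _ => ?_
  rw [Matrix.mul_assoc, transpose_res_mul_apply_off _ _ hx, abs_zero, zero_mul]

end Pad

/-! ## §3 The weighted row bounds of `R` ((2.51)/(2.65)) and of `G′₀` ((2.64)) -/

section Inputs

/-- **`sup_x roww_{δ₁}(R)(x) ≤ C_R/M`** — (2.51) in the weighted-row form, uniformly in the mesh `k ≥ 1`, `M_h ≥ 3`, the
volume, the block union and the window point. [cite: Balaban1984PropagatorsII, (2.51) p.232, (2.65) p.234] -/
theorem roww_rOp_le (d ℓ : ℕ) (hℓ : 1 ≤ ℓ) (aminus aplus m2plus a2minus a2plus : ℝ) (ha : 0 < aminus)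
    (ha2 : 0 < a2minus) :
    ∃ δ₁ CR : ℝ, 0 < δ₁ ∧ 0 < CR ∧ ∀ (k : ℕ), 1 ≤ k → ∀ (aj m2 a : ℝ), aminus ≤ aj → aj ≤ aplus → 0 ≤ m2 →
      m2 ≤ m2plus → a2minus ≤ a → a ≤ a2plus → ∀ (Mh : ℕ), 3 ≤ Mh → ∀ (P : Fin (d + 1) → ℕ) (hP : ∀ i, 1 ≤ P i)
        (Λ : Finset ↥(boxDom (fun i => (ℓ + 1) * (Mh * P i)))), IsBlockUnion ℓ (fun i => Mh * P i) Λ →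
        ∀ x : ↥(Box d ℓ k (fun i => (ℓ + 1) * (Mh * P i))),
          roww δ₁ ((ℓ + 1) ^ k) (B6Eq250.rOp (twoLevelOp ((ℓ + 1) ^ k) ℓ aj a m2 (fun i => Mh * P i) Λ)
            (hDiag ℓ k Mh P) (gPad ℓ k Mh P aj a m2 Λ hP)) x ≤ CR / (((ℓ : ℝ) + 1) * Mh) := by
  obtain ⟨δ', C', hδ', hC', h251⟩ := ineq251_twoLevelBox d ℓ hℓ aminus aplus m2plus a2minus a2plus ha ha2
  have hgap : 0 < 1 - Real.exp (-(δ' - δ' / 2)) := by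
    have : Real.exp (-(δ' - δ' / 2)) < 1 := Real.exp_lt_one_iff.2 (by linarith)
    linarith
  refine ⟨δ' / 2, C' * Real.exp (δ' / 2) / (1 - Real.exp (-(δ' - δ' / 2))), half_pos hδ', by positivity, ?_⟩
  intro k hk aj m2 a e1 e2 e3 e4 e5 e6 Mh hMh P hP Λ hΛ x
  have hn1 : 1 ≤ (ℓ + 1) ^ k := Nat.one_le_pow _ _ (by omega)
  have hMpos : (0 : ℝ) < ((ℓ : ℝ) + 1) * Mh := by
    have : (3 : ℝ) ≤ Mh := by exact_mod_cast hMh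
    have : (0 : ℝ) ≤ ℓ := Nat.cast_nonneg ℓ
    positivity
  have h := roww_le_of_mulVec_decay hn1 _ x (c := C' / (((ℓ : ℝ) + 1) * Mh)) (by positivity) (half_pos hδ').le
    (by linarith : δ' / 2 < δ') (fun g D hg hD => by
      have := h251 k hk aj m2 a e1 e2 e3 e4 e5 e6 Mh hMh P hP Λ hΛ g 1 D hg x hD
      rwa [mul_one] at this)
  calc _ ≤ C' / (((ℓ : ℝ) + 1) * Mh) * Real.exp (δ' / 2) / (1 - Real.exp (-(δ' - δ' / 2))) := h
    _ = C' * Real.exp (δ' / 2) / (1 - Real.exp (-(δ' - δ' / 2))) / (((ℓ : ℝ) + 1) * Mh) := by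
        field_simp

/-- **`sup_x roww_{δ₂}(G′₀)(x) ≤ 2^{d+1}c′`** — the (2.64)-input: each `h_qG′(□_q)h_q` has weighted rows `≤ c′` ((2.43)₁ on
the cut cube, `ineq243_twoLevel_roww`; `|h_q| ≤ 1`) and at most `2^{d+1}` of them meet a row.
[cite: Balaban1984PropagatorsII, (2.64) p.234, (2.43) p.230] -/
theorem roww_gZero_le (d ℓ : ℕ) (hℓ : 1 ≤ ℓ) (aminus aplus m2plus a2minus a2plus : ℝ) (ha : 0 < aminus)
    (ha2 : 0 < a2minus) :
    ∃ δ₂ c' : ℝ, 0 < δ₂ ∧ 0 < c' ∧ ∀ (k : ℕ), 1 ≤ k → ∀ (aj m2 a : ℝ), aminus ≤ aj → aj ≤ aplus → 0 ≤ m2 →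
      m2 ≤ m2plus → a2minus ≤ a → a ≤ a2plus → ∀ (Mh : ℕ), 1 ≤ Mh → ∀ (P : Fin (d + 1) → ℕ) (hP : ∀ i, 1 ≤ P i)
        (Λ : Finset ↥(boxDom (fun i => (ℓ + 1) * (Mh * P i)))),
        ∀ x : ↥(Box d ℓ k (fun i => (ℓ + 1) * (Mh * P i))),
          roww δ₂ ((ℓ + 1) ^ k) (B6Eq250.gZero (hDiag ℓ k Mh P) (gPad ℓ k Mh P aj a m2 Λ hP)) x ≤ 2 ^ (d + 1) * c' := by
  obtain ⟨δ', c', hδ', hc', h243⟩ := ineq243_twoLevel_roww d ℓ hℓ aminus aplus m2plus a2minus a2plus ha ha2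
  refine ⟨δ', c', hδ', hc', ?_⟩
  intro k hk aj m2 a e1 e2 e3 e4 e5 e6 Mh hMh P hP Λ x
  have hN1 : 1 ≤ (ℓ + 1) ^ k * ((ℓ + 1) * Mh) := Nat.one_le_iff_ne_zero.2 (by positivity)
  rw [B6Eq250.gZero_eq_sum_aTerm]
  refine (roww_sum_le _ _ _ _ x).trans ?_
  have hterm : ∀ q : ↥(ctrs P),
      roww δ' ((ℓ + 1) ^ k) (B6Eq250.aTerm (hDiag ℓ k Mh P) (gPad ℓ k Mh P aj a m2 Λ hP) q) x
        ≤ |hΩ ℓ k Mh P q.1 x| * c' := by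
    intro q
    have hM' : ∀ i, 1 ≤ cubeM' Mh P q.1 i := fun i =>
      Nat.one_le_iff_ne_zero.2 (Nat.mul_ne_zero_iff.2 ⟨by omega, by have := (one_le_cubeW hP q.2 i).1; omega⟩)
    rw [B6Eq250.aTerm_apply]
    unfold hDiag
    refine (roww_diag_mul_diag_le _ _ _ _ _ (fun y => abs_hq_le_one _ _ _ _) x).trans ?_
    refine mul_le_mul_of_nonneg_left ?_ (abs_nonneg _)
    unfold gPad cubeG
    by_cases hx : ∃ b, emb ℓ k Mh P q.1 hP q.2 b = x
    · obtain ⟨b, rfl⟩ := hx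
      rw [roww_pad_emb hP q.2]
      exact h243 k hk aj m2 a e1 e2 e3 e4 e5 e6 (cubeM' Mh P q.1) hM' (lamLoc ℓ Mh P q.1 hP q.2 Λ) b
    · push Not at hx
      rw [roww_pad_off hP q.2 _ _ _ hx]
      exact hc'.le
  have hterm' : ∀ q : ↥(ctrs P),
      roww δ' ((ℓ + 1) ^ k) (B6Eq250.aTerm (hDiag ℓ k Mh P) (gPad ℓ k Mh P aj a m2 Λ hP) q) x ≤ c' := fun q =>
    (hterm q).trans (by
      calc |hΩ ℓ k Mh P q.1 x| * c' ≤ 1 * c' := mul_le_mul_of_nonneg_right (abs_hq_le_one _ _ _ _) hc'.le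
        _ = c' := one_mul _)
  have key := sum_le_card_mul'
    (fun q : ↥(ctrs P) => roww δ' ((ℓ + 1) ^ k) (B6Eq250.aTerm (hDiag ℓ k Mh P) (gPad ℓ k Mh P aj a m2 Λ hP) q) x)
    (fun q => q.1) Subtype.val_injective (near ((ℓ + 1) ^ k * ((ℓ + 1) * Mh)) x.1)
    (fun q hq0 => by
      refine mem_near_of_abs_lt hN1 fun μ => ?_
      have h0 : hΩ ℓ k Mh P q.1 x ≠ 0 := by
        intro h0
        exact hq0 (le_antisymm ((hterm q).trans (by rw [h0, abs_zero, zero_mul])) (roww_nonneg _ _ _ _))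
      have hNr : (0 : ℝ) < (((ℓ + 1) ^ k * ((ℓ + 1) * Mh) : ℕ) : ℝ) := by exact_mod_cast hN1
      exact (abs_lt_of_hq_ne_zero hN1 h0 μ).trans (by nlinarith))
    hc'.le hterm'
  refine key.trans ?_
  have hcard : ((near ((ℓ + 1) ^ k * ((ℓ + 1) * Mh)) x.1).card : ℝ) ≤ 2 ^ (d + 1) := by
    exact_mod_cast card_near_le _ _
  nlinarith

end Inputs

/-! ## §4 (2.66) ⇒ (2.67)₁: the resummation for `G′ = (Δ_Ω^{L^{−j},N} + m² + Q′*aQ′)^{−1}` -/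

section Prop22

variable {ℓ k Mh : ℕ} {P : Fin (d + 1) → ℕ}

/-- **THE FIXED-POINT FORM OF (2.38)/(2.50)**: `G′ = G′₀ + G′R` (multiply `Δ′_aG′₀ = I − R` by `G′ = Δ′_a^{−1}` on the
left). [cite: Balaban1984PropagatorsII, (2.38) p.229, (2.50) p.232] -/
theorem gTwoLevel_eq_gZero_add (hℓ : 1 ≤ ℓ) (hk : 1 ≤ k) (hMh : 1 ≤ Mh) (hP : ∀ i, 1 ≤ P i) {aj a m2 : ℝ}
    (haj : 0 < aj) (ha : 0 < a) (hm : 0 ≤ m2) {Λ : Finset ↥(boxDom (fun i => (ℓ + 1) * (Mh * P i)))}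
    (hΛ : IsBlockUnion ℓ (fun i => Mh * P i) Λ) :
    gTwoLevel ((ℓ + 1) ^ k) ℓ aj a m2 (fun i => Mh * P i) Λ
      = B6Eq250.gZero (hDiag ℓ k Mh P) (gPad ℓ k Mh P aj a m2 Λ hP)
        + gTwoLevel ((ℓ + 1) ^ k) ℓ aj a m2 (fun i => Mh * P i) Λ
          * B6Eq250.rOp (twoLevelOp ((ℓ + 1) ^ k) ℓ aj a m2 (fun i => Mh * P i) Λ) (hDiag ℓ k Mh P)
              (gPad ℓ k Mh P aj a m2 Λ hP) := by
  have hn1 : 1 ≤ (ℓ + 1) ^ k := Nat.one_le_pow _ _ (by omega)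
  have hGD : gTwoLevel ((ℓ + 1) ^ k) ℓ aj a m2 (fun i => Mh * P i) Λ
      * twoLevelOp ((ℓ + 1) ^ k) ℓ aj a m2 (fun i => Mh * P i) Λ = 1 :=
    gTwoLevel_mul_twoLevelOp hn1 hℓ haj ha hm
      (fun i => Nat.one_le_iff_ne_zero.2 (Nat.mul_ne_zero_iff.2 ⟨by omega, by have := hP i; omega⟩)) hΛ
  have h238 := eq238_twoLevelBox (hP := hP) hℓ hk hMh haj ha hm hΛ
  have := congrArg (fun T => gTwoLevel ((ℓ + 1) ^ k) ℓ aj a m2 (fun i => Mh * P i) Λ * T) h238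
  rw [← Matrix.mul_assoc, hGD, Matrix.one_mul, Matrix.mul_sub, Matrix.mul_one] at this
  rw [this, sub_add_cancel]

/-- **[B6] PROPOSITION 2.2, FIRST ENTRY OF (2.67), FOR THE GENUINE TWO-LEVEL OPERATOR ON A BOX, ALONG THE PRINTED ROUTE**:
there are `δ, M₀, C > 0` (functions of `d`, `ℓ` and the window) such that for EVERY mesh `k ≥ 1`, `M_h ≥ 3` with
`L·M_h ≥ M₀` («M sufficiently large»), volume `P`, block union `Λ` and window point, the propagator
`G′ = (Δ_Ω^{L^{−j},N} + m² + Q′*aQ′)^{−1}` has `sup_x Σ_{x′}|G′(x,x′)|e^{δ|x−x′|_∞/n} ≤ C` — from `G′ = G′₀ + G′R`,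
`roww(G′₀) ≤ 2^{d+1}c′` ((2.64)-input), `sup roww(R) ≤ C_R/M ≤ ½` ((2.51)/(2.65)-input) and the submultiplicativity /
subadditivity of the weighted rows ((2.52)–(2.55), (2.66)). [cite: Balaban1984PropagatorsII, Proposition 2.2 (2.64)–(2.67) p.234] -/
theorem prop22_entry1_twoLevelBox (d ℓ : ℕ) (hℓ : 1 ≤ ℓ) (aminus aplus m2plus a2minus a2plus : ℝ) (ha : 0 < aminus)
    (ha2 : 0 < a2minus) :
    ∃ δ M₀ C : ℝ, 0 < δ ∧ 0 < M₀ ∧ 0 < C ∧ ∀ (k : ℕ), 1 ≤ k → ∀ (aj m2 a : ℝ), aminus ≤ aj → aj ≤ aplus → 0 ≤ m2 →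
      m2 ≤ m2plus → a2minus ≤ a → a ≤ a2plus → ∀ (Mh : ℕ), 3 ≤ Mh → M₀ ≤ ((ℓ : ℝ) + 1) * Mh →
        ∀ (P : Fin (d + 1) → ℕ), (∀ i, 1 ≤ P i) → ∀ (Λ : Finset ↥(boxDom (fun i => (ℓ + 1) * (Mh * P i)))),
        IsBlockUnion ℓ (fun i => Mh * P i) Λ →
        ∀ x : ↥(Box d ℓ k (fun i => (ℓ + 1) * (Mh * P i))),
          roww δ ((ℓ + 1) ^ k) (gTwoLevel ((ℓ + 1) ^ k) ℓ aj a m2 (fun i => Mh * P i) Λ) x ≤ C := by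
  obtain ⟨δ₁, CR, hδ₁, hCR, hR⟩ := roww_rOp_le d ℓ hℓ aminus aplus m2plus a2minus a2plus ha ha2
  obtain ⟨δ₂, c', hδ₂, hc', hG0⟩ := roww_gZero_le d ℓ hℓ aminus aplus m2plus a2minus a2plus ha ha2
  refine ⟨min δ₁ δ₂, 2 * CR, 2 * (2 ^ (d + 1) * c'), lt_min hδ₁ hδ₂, by positivity, by positivity, ?_⟩
  intro k hk aj m2 a e1 e2 e3 e4 e5 e6 Mh hMh hM P hP Λ hΛ x
  have hMh1 : 1 ≤ Mh := le_trans (by norm_num) hMh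
  have hδ0 : 0 ≤ min δ₁ δ₂ := (lt_min hδ₁ hδ₂).le
  have hMpos : (0 : ℝ) < ((ℓ : ℝ) + 1) * Mh := by
    have : (3 : ℝ) ≤ Mh := by exact_mod_cast hMh
    have : (0 : ℝ) ≤ ℓ := Nat.cast_nonneg ℓ
    positivity
  set G := gTwoLevel ((ℓ + 1) ^ k) ℓ aj a m2 (fun i => Mh * P i) Λ with hG
  set G₀ := B6Eq250.gZero (hDiag ℓ k Mh P) (gPad ℓ k Mh P aj a m2 Λ hP) with hG₀
  set Rm := B6Eq250.rOp (twoLevelOp ((ℓ + 1) ^ k) ℓ aj a m2 (fun i => Mh * P i) Λ) (hDiag ℓ k Mh P)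
    (gPad ℓ k Mh P aj a m2 Λ hP) with hRm
  -- the two inputs at the common rate `min δ₁ δ₂`
  have hRrow : ∀ x', roww (min δ₁ δ₂) ((ℓ + 1) ^ k) Rm x' ≤ 1 / 2 := by
    intro x'
    refine (roww_mono (min_le_left _ _) _ _ _).trans ((hR k hk aj m2 a e1 e2 e3 e4 e5 e6 Mh hMh P hP Λ hΛ x').trans ?_)
    calc CR / (((ℓ : ℝ) + 1) * Mh) ≤ CR / (2 * CR) := div_le_div_of_nonneg_left hCR.le (by positivity) hM
      _ = 1 / 2 := by field_simp
  have hG0row : ∀ x', roww (min δ₁ δ₂) ((ℓ + 1) ^ k) G₀ x' ≤ 2 ^ (d + 1) * c' := fun x' =>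
    (roww_mono (min_le_right _ _) _ _ _).trans (hG0 k hk aj m2 a e1 e2 e3 e4 e5 e6 Mh hMh1 P hP Λ x')
  -- the fixed point and the maximal row
  have hfix : G = G₀ + G * Rm :=
    gTwoLevel_eq_gZero_add hℓ hk hMh1 hP (lt_of_lt_of_le ha e1) (lt_of_lt_of_le ha2 e5) e3 hΛ
  obtain ⟨x₀, -, hx₀⟩ := Finset.exists_max_image Finset.univ (fun y => roww (min δ₁ δ₂) ((ℓ + 1) ^ k) G y)
    ⟨x, Finset.mem_univ x⟩
  have hmax : roww (min δ₁ δ₂) ((ℓ + 1) ^ k) G x₀ ≤ 2 ^ (d + 1) * c' + roww (min δ₁ δ₂) ((ℓ + 1) ^ k) G x₀ * (1 / 2) := by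
    calc roww (min δ₁ δ₂) ((ℓ + 1) ^ k) G x₀ = roww (min δ₁ δ₂) ((ℓ + 1) ^ k) (G₀ + G * Rm) x₀ := by rw [← hfix]
      _ ≤ roww (min δ₁ δ₂) ((ℓ + 1) ^ k) G₀ x₀ + roww (min δ₁ δ₂) ((ℓ + 1) ^ k) (G * Rm) x₀ := roww_add_le _ _ _ _ _
      _ ≤ 2 ^ (d + 1) * c' + roww (min δ₁ δ₂) ((ℓ + 1) ^ k) G x₀ * (1 / 2) :=
          add_le_add (hG0row x₀) (roww_mul_le hδ0 _ _ _ hRrow x₀)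
  have hx : roww (min δ₁ δ₂) ((ℓ + 1) ^ k) G x ≤ roww (min δ₁ δ₂) ((ℓ + 1) ^ k) G x₀ := hx₀ x (Finset.mem_univ x)
  linarith

/-- **KERNEL DECAY**: `|G′(x,x′)| ≤ Ce^{−δ|x−x′|_∞/n}` for the genuine two-level box propagator, same uniformity.
[cite: Balaban1984PropagatorsII, Proposition 2.2 (2.67) p.234] -/
theorem gTwoLevel_entry_decay (d ℓ : ℕ) (hℓ : 1 ≤ ℓ) (aminus aplus m2plus a2minus a2plus : ℝ) (ha : 0 < aminus)
    (ha2 : 0 < a2minus) :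
    ∃ δ M₀ C : ℝ, 0 < δ ∧ 0 < M₀ ∧ 0 < C ∧ ∀ (k : ℕ), 1 ≤ k → ∀ (aj m2 a : ℝ), aminus ≤ aj → aj ≤ aplus → 0 ≤ m2 →
      m2 ≤ m2plus → a2minus ≤ a → a ≤ a2plus → ∀ (Mh : ℕ), 3 ≤ Mh → M₀ ≤ ((ℓ : ℝ) + 1) * Mh →
        ∀ (P : Fin (d + 1) → ℕ), (∀ i, 1 ≤ P i) → ∀ (Λ : Finset ↥(boxDom (fun i => (ℓ + 1) * (Mh * P i)))),
        IsBlockUnion ℓ (fun i => Mh * P i) Λ →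
        ∀ x x' : ↥(Box d ℓ k (fun i => (ℓ + 1) * (Mh * P i))),
          |gTwoLevel ((ℓ + 1) ^ k) ℓ aj a m2 (fun i => Mh * P i) Λ x x'|
            ≤ C * Real.exp (-(δ * supNorm (x.1 - x'.1) / (((ℓ + 1) ^ k : ℕ) : ℝ))) := by
  obtain ⟨δ, M₀, C, hδ, hM₀, hC, h⟩ := prop22_entry1_twoLevelBox d ℓ hℓ aminus aplus m2plus a2minus a2plus ha ha2
  refine ⟨δ, M₀, C, hδ, hM₀, hC, ?_⟩
  intro k hk aj m2 a e1 e2 e3 e4 e5 e6 Mh hMh hM P hP Λ hΛ x x'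
  have hrow := h k hk aj m2 a e1 e2 e3 e4 e5 e6 Mh hMh hM P hP Λ hΛ x
  exact (abs_apply_le_roww _ _ x x').trans (mul_le_mul_of_nonneg_right hrow (Real.exp_pos _).le)

/-- **THE PRINTED VALUE FORM OF (2.67)₁**: `|(G′λ)(x)| ≤ Ce^{−δD/n}F` for `|λ| ≤ F` supported at sup-distance `≥ D` (fine
units; `D/n` on the `L^{−j}`-scale) from `x` («|(G′λ)(x)| ≤ O(1)…e^{−½δ₀d(y,y′)}|λ|, x ∈ B^j(y), supp λ ⊂ B^{j′}(y′)»), same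
uniformity. [cite: Balaban1984PropagatorsII, Proposition 2.2 (2.67) p.234] -/
theorem gTwoLevel_value_decay (d ℓ : ℕ) (hℓ : 1 ≤ ℓ) (aminus aplus m2plus a2minus a2plus : ℝ) (ha : 0 < aminus)
    (ha2 : 0 < a2minus) :
    ∃ δ M₀ C : ℝ, 0 < δ ∧ 0 < M₀ ∧ 0 < C ∧ ∀ (k : ℕ), 1 ≤ k → ∀ (aj m2 a : ℝ), aminus ≤ aj → aj ≤ aplus → 0 ≤ m2 →
      m2 ≤ m2plus → a2minus ≤ a → a ≤ a2plus → ∀ (Mh : ℕ), 3 ≤ Mh → M₀ ≤ ((ℓ : ℝ) + 1) * Mh →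
        ∀ (P : Fin (d + 1) → ℕ), (∀ i, 1 ≤ P i) → ∀ (Λ : Finset ↥(boxDom (fun i => (ℓ + 1) * (Mh * P i)))),
        IsBlockUnion ℓ (fun i => Mh * P i) Λ →
        ∀ (f : ↥(Box d ℓ k (fun i => (ℓ + 1) * (Mh * P i))) → ℝ) (F D : ℝ), (∀ x', |f x'| ≤ F) →
        ∀ x : ↥(Box d ℓ k (fun i => (ℓ + 1) * (Mh * P i))), (∀ x', f x' ≠ 0 → D ≤ supNorm (x.1 - x'.1)) →
          |(gTwoLevel ((ℓ + 1) ^ k) ℓ aj a m2 (fun i => Mh * P i) Λ *ᵥ f) x|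
            ≤ C * Real.exp (-(δ * D / (((ℓ + 1) ^ k : ℕ) : ℝ))) * F := by
  obtain ⟨δ, M₀, C, hδ, hM₀, hC, h⟩ := prop22_entry1_twoLevelBox d ℓ hℓ aminus aplus m2plus a2minus a2plus ha ha2
  refine ⟨δ, M₀, C, hδ, hM₀, hC, ?_⟩
  intro k hk aj m2 a e1 e2 e3 e4 e5 e6 Mh hMh hM P hP Λ hΛ f F D hF x hD
  exact mulVec_le_of_roww hδ.le _ _ x (h k hk aj m2 a e1 e2 e3 e4 e5 e6 Mh hMh hM P hP Λ hΛ x) f hF hD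

end Prop22

end

end Literature.MathematicalPhysics.QuantumFieldTheory.Balaban1983to89.B6Prop22TwoLevelBox
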